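import Mathlib

/-!
# X193 kernel, layer C (F14): a point of the unit circle where `|q|` dominates the coefficients,
# and the resultant of a coprime integer pair

Solo-informed Schanuel programme, X193 kernel (DESIGN `work/s213/X193-KERNEL-DESIGN.md`,
Amendment A17).  Two arithmetic-free inputs of the in-tree proof of Roy's Proposition 3.1 at
`t = 1` (D. Roy, *Small value estimates for the additive group*, Int. J. Number Theory 6
(2010), §3):

* `soloX_exists_norm_eval_ge_coeff`: for every complex polynomial `q` there is `z` with
  `‖z‖ = 1` and `‖coeff_i q‖ ≤ ‖q (z)‖` for all `i` — by AVERAGING over the `N`-th roots of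
  unity, `N = deg q + 1`: `∑_{i<N} q(ζ^i) ζ^{i(N-k)} = N · coeff_k q`.  This replaces the
  Cauchy-inequality sentence of Roy's Lemma 3.6 (the padding root);
* `soloX_resultant_ne_zero`, `soloX_one_le_norm_resultant`: for `F ∈ ℤ[X]` irreducible and
  primitive and `F ∤ G`, the resultant `Res (F, G)` is a nonzero integer (Gauss's lemma moves
  the coprimality to `ℚ[X]`, where Mathlib's `resultant_ne_zero` applies), so
  `‖Res (F, G)‖ ≥ 1` in `ℂ`.

No definitions.
-/

namespace Summit.Schanuel.Schanuel.Theorems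

open Polynomial Finset

/-! ## Averaging over roots of unity -/

/-- Orthogonality of the `N`-th roots of unity `ζ^i` against the monomials: for `j, k < N`,
`∑_{i<N} (ζ^{j + (N - k)})^i = N` if `j = k` and `0` otherwise. -/
theorem soloX_rootsOfUnity_sum {ζ : ℂ} {N : ℕ} (hprim : IsPrimitiveRoot ζ N) {j k : ℕ}
    (hj : j < N) (hk : k < N) :
    ∑ i ∈ range N, (ζ ^ (j + (N - k))) ^ i = if j = k then (N : ℂ) else 0 := by
  split_ifs with hjk
  · subst hjk
    have h1 : ζ ^ (j + (N - j)) = 1 := by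
      rw [Nat.add_sub_cancel' hj.le]
      exact hprim.pow_eq_one
    simp [h1]
  · have hne : ζ ^ (j + (N - k)) ≠ 1 := by
      rw [Ne, hprim.pow_eq_one_iff_dvd]
      intro hdvd
      have := Nat.eq_of_dvd_of_lt_two_mul (by omega) hdvd (by omega)
      omega
    rw [geom_sum_eq hne, ← pow_mul, mul_comm, pow_mul, hprim.pow_eq_one, one_pow, sub_self,
      zero_div]

/-- The averaging identity: for `N = deg q + 1`, `ζ` a primitive `N`-th root of unity and
`k < N`, `∑_{i<N} q(ζ^i) (ζ^i)^(N-k) = N · coeff_k q`. -/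
theorem soloX_rootsOfUnity_average (q : ℂ[X]) {ζ : ℂ}
    (hprim : IsPrimitiveRoot ζ (q.natDegree + 1)) {k : ℕ} (hk : k < q.natDegree + 1) :
    ∑ i ∈ range (q.natDegree + 1), q.eval (ζ ^ i) * (ζ ^ i) ^ (q.natDegree + 1 - k) =
      (q.natDegree + 1 : ℕ) * q.coeff k := by
  set N := q.natDegree + 1 with hN
  calc ∑ i ∈ range N, q.eval (ζ ^ i) * (ζ ^ i) ^ (N - k)
      = ∑ i ∈ range N, ∑ j ∈ range N, q.coeff j * (ζ ^ (j + (N - k))) ^ i := by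
        refine Finset.sum_congr rfl fun i _ => ?_
        rw [eval_eq_sum_range, ← hN, Finset.sum_mul]
        refine Finset.sum_congr rfl fun j _ => ?_
        rw [mul_assoc, ← pow_add, ← pow_mul, pow_mul']
    _ = ∑ j ∈ range N, q.coeff j * ∑ i ∈ range N, (ζ ^ (j + (N - k))) ^ i := by
        rw [Finset.sum_comm]
        exact Finset.sum_congr rfl fun j _ => (Finset.mul_sum _ _ _).symm
    _ = ∑ j ∈ range N, q.coeff j * (if j = k then (N : ℂ) else 0) :=
        Finset.sum_congr rfl fun j hj => by
          rw [soloX_rootsOfUnity_sum hprim (Finset.mem_range.mp hj) hk]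
    _ = (N : ℂ) * q.coeff k := by
        simp [Finset.sum_ite_eq', Finset.mem_range.mpr hk, mul_comm]

/-- **A point of the unit circle where `|q|` dominates every coefficient.**  For every
`q ∈ ℂ[X]` there is `z` with `‖z‖ = 1` and `‖coeff_i q‖ ≤ ‖q (z)‖` for all `i` (take the
`N`-th root of unity `ζ^i`, `N = deg q + 1`, at which `‖q‖` is largest, and average). -/
theorem soloX_exists_norm_eval_ge_coeff (q : ℂ[X]) :
    ∃ z : ℂ, ‖z‖ = 1 ∧ ∀ i, ‖q.coeff i‖ ≤ ‖q.eval z‖ := by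
  set N := q.natDegree + 1 with hN
  have hN0 : N ≠ 0 := Nat.succ_ne_zero _
  set ζ : ℂ := Complex.exp (2 * Real.pi * Complex.I / N) with hζ
  have hprim : IsPrimitiveRoot ζ N := Complex.isPrimitiveRoot_exp N hN0
  have hnorm : ‖ζ‖ = 1 := hprim.norm'_eq_one hN0
  obtain ⟨i₀, hi₀, hmax⟩ := Finset.exists_max_image (range N) (fun i => ‖q.eval (ζ ^ i)‖)
    ⟨0, Finset.mem_range.mpr (Nat.pos_of_ne_zero hN0)⟩
  refine ⟨ζ ^ i₀, by rw [norm_pow, hnorm, one_pow], fun k => ?_⟩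
  by_cases hk : k < N
  swap
  · rw [coeff_eq_zero_of_natDegree_lt (by omega), norm_zero]
    exact norm_nonneg _
  have hident := soloX_rootsOfUnity_average q hprim hk
  have hle : (N : ℝ) * ‖q.coeff k‖ ≤ N * ‖q.eval (ζ ^ i₀)‖ := by
    have h1 : ‖((N : ℕ) : ℂ) * q.coeff k‖ = N * ‖q.coeff k‖ := by
      rw [norm_mul, Complex.norm_natCast]
    rw [← h1, ← hident]
    calc ‖∑ i ∈ range N, q.eval (ζ ^ i) * (ζ ^ i) ^ (N - k)‖
        ≤ ∑ i ∈ range N, ‖q.eval (ζ ^ i) * (ζ ^ i) ^ (N - k)‖ := norm_sum_le _ _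
      _ = ∑ i ∈ range N, ‖q.eval (ζ ^ i)‖ :=
          Finset.sum_congr rfl fun i _ => by
            rw [norm_mul, norm_pow, norm_pow, hnorm, one_pow, one_pow, mul_one]
      _ ≤ ∑ _i ∈ range N, ‖q.eval (ζ ^ i₀)‖ := Finset.sum_le_sum fun i hi => hmax i hi
      _ = N * ‖q.eval (ζ ^ i₀)‖ := by
          rw [Finset.sum_const, Finset.card_range, nsmul_eq_mul]
  exact le_of_mul_le_mul_left hle (by positivity)

/-! ## The resultant of a coprime integer pair -/

/-- For `F ∈ ℤ[X]` irreducible and primitive with `F ∤ G`, `Res (F, G) ≠ 0` (Gauss's lemma: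
`F` stays irreducible in `ℚ[X]` and still does not divide `G` there, so `F, G` are coprime in
`ℚ[X]` and Mathlib's `resultant_ne_zero` applies; the resultant commutes with `ℤ → ℚ`). -/
theorem soloX_resultant_ne_zero {F G : ℤ[X]} (hFirr : Irreducible F) (hFp : F.IsPrimitive)
    (hndvd : ¬ F ∣ G) : resultant F G ≠ 0 := by
  have hirrQ : Irreducible (F.map (Int.castRingHom ℚ)) :=
    (IsPrimitive.Int.irreducible_iff_irreducible_map_cast hFp).mp hFirr
  have hndvdQ : ¬ F.map (Int.castRingHom ℚ) ∣ G.map (Int.castRingHom ℚ) := fun h =>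
    hndvd ((IsPrimitive.Int.dvd_iff_map_cast_dvd_map_cast F G hFp).mpr h)
  have hcop : IsCoprime (F.map (Int.castRingHom ℚ)) (G.map (Int.castRingHom ℚ)) :=
    hirrQ.coprime_iff_not_dvd.mpr hndvdQ
  have hres := resultant_ne_zero _ _ hcop
  rw [natDegree_map_eq_of_injective (Int.castRingHom ℚ).injective_int,
    natDegree_map_eq_of_injective (Int.castRingHom ℚ).injective_int, resultant_map_map] at hres
  exact fun h => hres (by rw [h, map_zero])

/-- Hence `‖Res (F, G)‖ ≥ 1` in `ℂ` for such a pair. -/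
theorem soloX_one_le_norm_resultant {F G : ℤ[X]} (hFirr : Irreducible F) (hFp : F.IsPrimitive)
    (hndvd : ¬ F ∣ G) : 1 ≤ ‖((resultant F G : ℤ) : ℂ)‖ := by
  rw [Complex.norm_intCast]
  exact_mod_cast Int.one_le_abs (soloX_resultant_ne_zero hFirr hFp hndvd)

/-- The resultant of the complexified pair is the complexified integer resultant:
`Res (F_ℂ, G_ℂ)_{deg F, deg G} = (Res (F, G) : ℂ)`. -/
theorem soloX_resultant_map_intCast (F G : ℤ[X]) :
    resultant (F.map (algebraMap ℤ ℂ)) (G.map (algebraMap ℤ ℂ)) F.natDegree G.natDegree =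
      ((resultant F G : ℤ) : ℂ) := by
  rw [resultant_map_map, eq_intCast]

end Summit.Schanuel.Schanuel.Theorems
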